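import Literature.AlgebraicGeometry.Resolution.WeightedCentreGradedIsotropy
import Literature.AlgebraicGeometry.Resolution.WeightedCentreHeavyTaylor
import Mathlib.Tactic.Linarith
import HarnessLib

/-!
# LEMMA KL (i)–(iii): killing an initial segment of slots (instrument, NOT a resolution theorem)

Engine 1 of the RESOLUTION OBSERVATORY toy model `W(f)` (RE-DERIVATION-eng1-g41 §3.1, LEMMA KL; CARVER-NOTES-eng1-g41 T82
(i)–(iii)) reduces a graded endomorphism `Φ` of `k[ε][σ]` modulo an INITIAL SEGMENT of slots: `H` the kept slots, the killed
slots `z` (`¬ H z`) all strictly LIGHTER than every kept slot, and `Φ` without pure `σ^s`-terms on the killed slots.  Then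

* (i) `Φ` maps every killed slot into the ideal of the killed slots — typed as `killHom H (Φ (C ε_z)) = 0`
  (`killHom_map_CX_eq_zero`: a monomial of weight `≤ w z` cannot contain a kept variable, and the bare monomial is
  excluded by `pureCoeff Φ z s = 0`), so the REDUCTION `reduce H Φ := killHom H ∘ Φ` satisfies `reduce H Φ ∘ killHom H = reduce H Φ`
  (`reduce_comp_killHom`) — it is the endomorphism `Φ̄` induced on `k[ε_H][σ] = killHom H (k[ε][σ])`;
* (ii) `IsGradedIso w ρ G Φ → IsGradedIso w ρ (killLight H G) (reduce H Φ)` (`isGradedIso_reduce`);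
* (iii) `pureCoeff (reduce H Φ) x s = pureCoeff Φ x s` for every slot (`pureCoeff_reduce`);
* (i) unfolded, for T84: `reduce H Φ = killHom H ↔ ∀ x, H x → killHom H (Φ (C ε_x)) = C ε_x` ("`Φ̄ = id` iff every kept shift
  lies in the ideal of the killed slots", `reduce_eq_killHom_iff`).

Here `killHom H` is the coefficientwise variable kill `ε_z ↦ 0 (¬ H z)` of `WeightedCentreHeavyTaylor` (`killLight H`) on
`k[ε][σ] = (MvPolynomial ι k)[X]`; weights are rational and non-negative, `deg σ = ρ ≥ 0`.  (iv) ((P)-inheritance) is not in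
this file.  References: the weighted frame [AbramovichTemkinWlodarczyk2024, Thm. 5.3.1 (2)–(3) (p. 1578), §5.1 (p. 1575)].
All statements are OURS (toy-model bookkeeping).
-/

namespace Literature.AlgebraicGeometry.Resolution.WeightedBlowup

open Polynomial

namespace KillSegment

variable {k : Type*} [CommRing k] {ι : Type*} (H : ι → Prop) [DecidablePred H]

/-! ## The coefficientwise kill -/

/-- `killHom H : k[ε][σ] → k[ε][σ]`, `ε_z ↦ 0` for `¬ H z`, coefficientwise in `σ` (ours). [cite: AbramovichTemkinWlodarczyk2024, §5.1 (p. 1575)] -/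
noncomputable def killHom : (MvPolynomial ι k)[X] →+* (MvPolynomial ι k)[X] :=
  Polynomial.mapRingHom (killLight (S := k) H).toRingHom

/-- Plumbing (ours). [cite: AbramovichTemkinWlodarczyk2024, §5.1 (p. 1575)] -/
theorem coeff_killHom (f : (MvPolynomial ι k)[X]) (s : ℕ) : (killHom H f).coeff s = killLight H (f.coeff s) := by
  rw [killHom, Polynomial.coe_mapRingHom, Polynomial.coeff_map, AlgHom.toRingHom_eq_coe, RingHom.coe_coe]

/-- Plumbing (ours). [cite: AbramovichTemkinWlodarczyk2024, §5.1 (p. 1575)] -/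
@[simp] theorem killHom_C (q : MvPolynomial ι k) : killHom H (C q) = C (killLight H q) := by
  rw [killHom, Polynomial.coe_mapRingHom, Polynomial.map_C, AlgHom.toRingHom_eq_coe, RingHom.coe_coe]

/-- Plumbing (ours). [cite: AbramovichTemkinWlodarczyk2024, §5.1 (p. 1575)] -/
@[simp] theorem killHom_X : killHom H (X : (MvPolynomial ι k)[X]) = X := by
  rw [killHom, Polynomial.coe_mapRingHom, Polynomial.map_X]

/-- Scalars are fixed (ours). [cite: AbramovichTemkinWlodarczyk2024, §5.1 (p. 1575)] -/
@[simp] theorem killHom_C_C (c : k) : killHom H (C (MvPolynomial.C c) : (MvPolynomial ι k)[X]) = C (MvPolynomial.C c) := by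
  rw [killHom_C, MvPolynomial.algHom_C, MvPolynomial.algebraMap_eq]

/-- Kept slots are fixed (ours). [cite: AbramovichTemkinWlodarczyk2024, §5.1 (p. 1575)] -/
theorem killHom_C_X_of {x : ι} (hx : H x) : killHom H (C (MvPolynomial.X x) : (MvPolynomial ι k)[X]) = C (MvPolynomial.X x) := by
  rw [killHom_C, killLight_X, heavyX, if_pos hx]

/-- Killed slots die (ours). [cite: AbramovichTemkinWlodarczyk2024, §5.1 (p. 1575)] -/
theorem killHom_C_X_of_not {z : ι} (hz : ¬ H z) : killHom H (C (MvPolynomial.X z) : (MvPolynomial ι k)[X]) = 0 := by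
  rw [killHom_C, killLight_X, heavyX, if_neg hz, map_zero]

/-- `killLight` is idempotent (ours). [cite: AbramovichTemkinWlodarczyk2024, §5.1 (p. 1575)] -/
theorem killLight_killLight (q : MvPolynomial ι k) : killLight H (killLight H q) = killLight H q := by
  have key : (killLight (S := k) H).comp (killLight H) = killLight (ι := ι) H := by
    refine MvPolynomial.algHom_ext fun i => ?_
    rw [AlgHom.comp_apply, killLight_X, heavyX]
    split_ifs with hi
    · rw [killLight_X, heavyX, if_pos hi]
    · rw [map_zero]
  exact congrArg (fun φ : MvPolynomial ι k →ₐ[k] MvPolynomial ι k => φ q) key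

/-- `killHom` is idempotent (ours): it is the projection onto `k[ε_H][σ]`. [cite: AbramovichTemkinWlodarczyk2024, §5.1 (p. 1575)] -/
theorem killHom_killHom (f : (MvPolynomial ι k)[X]) : killHom H (killHom H f) = killHom H f := by
  refine Polynomial.ext fun s => ?_
  rw [coeff_killHom, coeff_killHom, killLight_killLight]

/-- `killHom ∘ killHom = killHom` (ours). [cite: AbramovichTemkinWlodarczyk2024, §5.1 (p. 1575)] -/
theorem killHom_comp_killHom : (killHom (k := k) (ι := ι) H).comp (killHom H) = killHom H :=
  RingHom.ext fun f => killHom_killHom H f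

section Graded

variable {w : ι → ℚ} {ρ : ℚ}

/-- The kill preserves total weight (ours). [cite: AbramovichTemkinWlodarczyk2024, Thm. 5.3.1 (2)–(3) (p. 1578)] -/
theorem isTW_killHom {n : ℚ} {f : (MvPolynomial ι k)[X]} (hf : IsTW w ρ n f) : IsTW w ρ n (killHom H f) := by
  intro s t ht
  rw [coeff_killHom, coeff_killLight] at ht
  split_ifs at ht with hHt
  · exact hf s ht
  · exact absurd rfl ht

/-- The kill is a graded endomorphism (ours). [cite: AbramovichTemkinWlodarczyk2024, Thm. 5.3.1 (2)–(3) (p. 1578)] -/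
theorem isGradedHom_killHom : IsGradedHom w ρ (killHom (k := k) (ι := ι) H) where
  map_C_C := killHom_C_C H
  isTW_X := by rw [killHom_X]; exact isTW_X
  isTW_CX x := isTW_killHom H (isTW_C (MvPolynomial.isWeightedHomogeneous_X k w x))

/-- Lower bound for the weight of a monomial by one of its variables (ours, bookkeeping; non-negative weights).
[cite: AbramovichTemkinWlodarczyk2024, §5.1 (p. 1575)] -/
theorem le_weight_of_mem_support' (hw : ∀ j, 0 ≤ w j) (κ : ι →₀ ℕ) {x : ι} (hx : x ∈ κ.support) :
    w x ≤ Finsupp.weight w κ := by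
  rw [Finsupp.weight_apply, Finsupp.sum]
  have h1 : (1 : ℚ) ≤ κ x := by exact_mod_cast Nat.one_le_iff_ne_zero.mpr (Finsupp.mem_support_iff.mp hx)
  calc w x ≤ (κ x : ℚ) * w x := by nlinarith [hw x]
    _ = κ x • w x := (nsmul_eq_mul _ _).symm
    _ ≤ ∑ j ∈ κ.support, κ j • w j :=
        Finset.single_le_sum (f := fun j => κ j • w j) (fun j _ => nsmul_nonneg (hw j) _) hx

/-- **LEMMA KL (i)** (ours): if the killed slots are strictly lighter than the kept ones and `Φ` is graded with NO pure term on the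
killed slot `z`, then `Φ (C ε_z)` dies under the kill — i.e. `Φ` maps `ε_z` into the ideal of the killed slots.  (A monomial of
`(Φ ε_z)_s` has weight `w z − sρ ≤ w z < w x` for every kept `x`, so it contains no kept variable; the bare monomial is the pure
term.) [cite: AbramovichTemkinWlodarczyk2024, Thm. 5.3.1 (2)–(3) (p. 1578)] -/
theorem killHom_map_CX_eq_zero (hw : ∀ j, 0 ≤ w j) (hρ : 0 ≤ ρ) (hsep : ∀ z x, ¬ H z → H x → w z < w x)
    {Φ : (MvPolynomial ι k)[X] →+* (MvPolynomial ι k)[X]} (hΦ : IsGradedHom w ρ Φ) {z : ι} (hz : ¬ H z)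
    (hpure : ∀ s, pureCoeff Φ z s = 0) : killHom H (Φ (C (MvPolynomial.X z))) = 0 := by
  refine Polynomial.ext fun s => ?_
  rw [coeff_killHom, Polynomial.coeff_zero, killLight_eq_C_coeff_zero H _ (fun κ hκ hκ0 hheavy => ?_),
    show MvPolynomial.coeff 0 ((Φ (C (MvPolynomial.X z))).coeff s) = 0 from hpure s, map_zero]
  obtain ⟨x, hx⟩ := Finsupp.support_nonempty_iff.mpr hκ0
  have hwt : Finsupp.weight w κ = w z - s • ρ := (hΦ.isTW_CX z) s (MvPolynomial.mem_support_iff.mp hκ)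
  have hle : w x ≤ Finsupp.weight w κ := le_weight_of_mem_support' hw κ hx
  have hsρ : (0 : ℚ) ≤ s • ρ := nsmul_nonneg hρ s
  have hlt := hsep z x hz (hheavy x hx)
  linarith

end Graded

/-! ## The reduction `Φ̄ = killHom ∘ Φ` -/

/-- `Φ̄ := killHom H ∘ Φ` (ours): the endomorphism induced on `k[ε_H][σ]`, extended by the kill. [cite: AbramovichTemkinWlodarczyk2024, §5.1 (p. 1575)] -/
noncomputable def reduce (Φ : (MvPolynomial ι k)[X] →+* (MvPolynomial ι k)[X]) : (MvPolynomial ι k)[X] →+* (MvPolynomial ι k)[X] :=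
  (killHom H).comp Φ

/-- Plumbing (ours). [cite: AbramovichTemkinWlodarczyk2024, §5.1 (p. 1575)] -/
theorem reduce_apply (Φ : (MvPolynomial ι k)[X] →+* (MvPolynomial ι k)[X]) (f : (MvPolynomial ι k)[X]) :
    reduce H Φ f = killHom H (Φ f) := rfl

/-- **LEMMA KL (i), as compatibility** (ours): if every killed slot dies under `killHom ∘ Φ`, then `Φ̄ ∘ kill = Φ̄` — `Φ̄` factors
through the projection onto `k[ε_H][σ]`.
[cite: AbramovichTemkinWlodarczyk2024, §5.1 (p. 1575)] -/
theorem reduce_comp_killHom {Φ : (MvPolynomial ι k)[X] →+* (MvPolynomial ι k)[X]}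
    (hZ : ∀ z, ¬ H z → killHom H (Φ (C (MvPolynomial.X z))) = 0) :
    (reduce H Φ).comp (killHom H) = reduce H Φ := by
  refine Polynomial.ringHom_ext (fun q => ?_) (by rw [RingHom.comp_apply, killHom_X])
  have key : ((reduce H Φ).comp (killHom H)).comp C = (reduce H Φ).comp C := by
    refine MvPolynomial.ringHom_ext (fun c => by simp only [RingHom.comp_apply, killHom_C_C]) fun x => ?_
    simp only [RingHom.comp_apply, reduce_apply]
    by_cases hx : H x
    · rw [killHom_C_X_of H hx]
    · rw [killHom_C_X_of_not H hx, map_zero, map_zero, hZ x hx]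
  exact RingHom.congr_fun key q

/-- Killed slots die under `Φ̄` too, under the same hypothesis (ours). [cite: AbramovichTemkinWlodarczyk2024, §5.1 (p. 1575)] -/
theorem reduce_C_X_of_not {Φ : (MvPolynomial ι k)[X] →+* (MvPolynomial ι k)[X]}
    (hZ : ∀ z, ¬ H z → killHom H (Φ (C (MvPolynomial.X z))) = 0) {z : ι} (hz : ¬ H z) :
    reduce H Φ (C (MvPolynomial.X z)) = 0 :=
  hZ z hz

/-- **LEMMA KL (iii)** (ours): the reduction has the same pure coefficients. [cite: AbramovichTemkinWlodarczyk2024, Thm. 5.3.1 (2)–(3) (p. 1578)] -/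
theorem pureCoeff_reduce (Φ : (MvPolynomial ι k)[X] →+* (MvPolynomial ι k)[X]) (x : ι) (s : ℕ) :
    pureCoeff (reduce H Φ) x s = pureCoeff Φ x s := by
  unfold pureCoeff
  rw [reduce_apply, coeff_killHom, coeff_killLight_of_isHeavy H (fun i hi => absurd hi (by simp))]

section Graded

variable {w : ι → ℚ} {ρ : ℚ}

/-- The reduction of a graded endomorphism is graded (ours). [cite: AbramovichTemkinWlodarczyk2024, Thm. 5.3.1 (2)–(3) (p. 1578)] -/
theorem isGradedHom_reduce {Φ : (MvPolynomial ι k)[X] →+* (MvPolynomial ι k)[X]} (hΦ : IsGradedHom w ρ Φ) :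
    IsGradedHom w ρ (reduce H Φ) :=
  (isGradedHom_killHom H).comp hΦ

/-- **LEMMA KL (ii)** (ours): killed slots strictly lighter than kept ones, no pure term on the killed slots: a graded isotropy of `G`
reduces to a graded isotropy of `killLight H G` (the equation of the face with the initial segment killed).
[cite: AbramovichTemkinWlodarczyk2024, Thm. 5.3.1 (2)–(3) (p. 1578)] -/
theorem isGradedIso_reduce (hw : ∀ j, 0 ≤ w j) (hρ : 0 ≤ ρ) (hsep : ∀ z x, ¬ H z → H x → w z < w x)
    {G : MvPolynomial ι k} {Φ : (MvPolynomial ι k)[X] →+* (MvPolynomial ι k)[X]} (hΦ : IsGradedIso w ρ G Φ)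
    (hpure : ∀ z, ¬ H z → ∀ s, pureCoeff Φ z s = 0) : IsGradedIso w ρ (killLight H G) (reduce H Φ) where
  graded := isGradedHom_reduce H hΦ.graded
  map_X := by rw [reduce_apply, hΦ.map_X, killHom_X]
  iso := by
    have hZ : ∀ z, ¬ H z → killHom H (Φ (C (MvPolynomial.X z))) = 0 := fun z hz =>
      killHom_map_CX_eq_zero H hw hρ hsep hΦ.graded hz (hpure z hz)
    have h := RingHom.congr_fun (reduce_comp_killHom H hZ) (C G)
    rw [RingHom.comp_apply, killHom_C] at h
    change KillSegment.reduce H Φ (C (killLight H G)) = C (killLight H G)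
    rw [h, reduce_apply, show Φ (C G) = C G from hΦ.iso, killHom_C]

/-- The hypothesis of (ii) packaged: every killed slot dies under `killHom ∘ Φ` (ours). [cite: AbramovichTemkinWlodarczyk2024, Thm. 5.3.1 (2)–(3) (p. 1578)] -/
theorem killHom_map_CX_eq_zero_of_isGradedIso (hw : ∀ j, 0 ≤ w j) (hρ : 0 ≤ ρ)
    (hsep : ∀ z x, ¬ H z → H x → w z < w x) {G : MvPolynomial ι k} {Φ : (MvPolynomial ι k)[X] →+* (MvPolynomial ι k)[X]}
    (hΦ : IsGradedIso w ρ G Φ) (hpure : ∀ z, ¬ H z → ∀ s, pureCoeff Φ z s = 0) {z : ι} (hz : ¬ H z) :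
    killHom H (Φ (C (MvPolynomial.X z))) = 0 :=
  killHom_map_CX_eq_zero H hw hρ hsep hΦ.graded hz (hpure z hz)

end Graded

/-- **LEMMA KL (i) unfolded, for T84** (ours): `Φ̄` is the identity of `k[ε_H][σ]` (i.e. `Φ̄ = kill`) iff every KEPT shift
`Φ(ε_x) − ε_x` lies in the ideal of the killed slots (dies under the kill) — given that `Φ` fixes scalars and `σ` and the killed
slots die. [cite: AbramovichTemkinWlodarczyk2024, Thm. 5.3.1 (2)–(3) (p. 1578)] -/
theorem reduce_eq_killHom_iff {Φ : (MvPolynomial ι k)[X] →+* (MvPolynomial ι k)[X]}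
    (hC : ∀ c : k, Φ (C (MvPolynomial.C c)) = C (MvPolynomial.C c)) (hX : Φ X = X)
    (hZ : ∀ z, ¬ H z → killHom H (Φ (C (MvPolynomial.X z))) = 0) :
    reduce H Φ = killHom H ↔ ∀ x, H x → killHom H (Φ (C (MvPolynomial.X x))) = C (MvPolynomial.X x) := by
  constructor
  · intro h x hx
    rw [← reduce_apply, h, killHom_C_X_of H hx]
  · intro h
    refine Polynomial.ringHom_ext (fun q => ?_) (by rw [reduce_apply, hX])
    have key : (reduce H Φ).comp C = (killHom H).comp C := by
      refine MvPolynomial.ringHom_ext (fun c => by simp only [RingHom.comp_apply, reduce_apply, hC, killHom_C_C]) fun x => ?_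
      simp only [RingHom.comp_apply, reduce_apply]
      by_cases hx : H x
      · rw [h x hx, killHom_C_X_of H hx]
      · rw [hZ x hx, killHom_C_X_of_not H hx]
    exact RingHom.congr_fun key q

/-- … equivalently `Φ(ε_x) − ε_x` dies under the kill (ours). [cite: AbramovichTemkinWlodarczyk2024, Thm. 5.3.1 (2)–(3) (p. 1578)] -/
theorem reduce_eq_killHom_iff_sub {Φ : (MvPolynomial ι k)[X] →+* (MvPolynomial ι k)[X]}
    (hC : ∀ c : k, Φ (C (MvPolynomial.C c)) = C (MvPolynomial.C c)) (hX : Φ X = X)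
    (hZ : ∀ z, ¬ H z → killHom H (Φ (C (MvPolynomial.X z))) = 0) :
    reduce H Φ = killHom H ↔ ∀ x, H x → killHom H (Φ (C (MvPolynomial.X x)) - C (MvPolynomial.X x)) = 0 := by
  rw [reduce_eq_killHom_iff H hC hX hZ]
  refine forall_congr' fun x => imp_congr_right fun hx => ?_
  rw [map_sub, killHom_C_X_of H hx, sub_eq_zero]

/-! ## A worked instance -/

/-- Smoke test (ours): `ι = Fin 2`, kept slot `1`, killed slot `0`; the kill sends `C ε₀ ↦ 0`, `C ε₁ ↦ C ε₁`, `σ ↦ σ`.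
[cite: AbramovichTemkinWlodarczyk2024, §5.1 (p. 1575)] -/
example : killHom (k := ℚ) (fun i : Fin 2 => i = 1) (C (MvPolynomial.X 0) + C (MvPolynomial.X 1) * X)
    = C (MvPolynomial.X 1) * X := by
  rw [map_add, map_mul, killHom_X, killHom_C_X_of (fun i : Fin 2 => i = 1) (show (1 : Fin 2) = 1 from rfl),
    killHom_C_X_of_not (fun i : Fin 2 => i = 1) (show ¬ ((0 : Fin 2) = 1) by decide), zero_add]

end KillSegment

end Literature.AlgebraicGeometry.Resolution.WeightedBlowup
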